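import Mathlib.NumberTheory.Modular
import HarnessLib

/-!
# A fundamental domain for `GL₂(ℤ)` (i.e. `PGL₂(ℤ)`) on the upper half plane: the half `0 ≤ Re z` of the modular triangle

Topic `Literature/NumberTheory/ModularForms`; built on Mathlib's `Mathlib.NumberTheory.Modular`
(`ModularGroup.fd = 𝒟 = {|Re z| ≤ ½, |z| ≥ 1}`, `fdo = 𝒟ᵒ`, `exists_smul_mem_fd`,
`eq_one_or_neg_one_of_mem_fdo_mem_fdo`) and its action of `GL(2, ℝ)` on `ℍ` by Möbius
transformations composed with complex conjugation for matrices of negative determinant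
(`UpperHalfPlane.glAction`, `σ`).

For counting `GL₂(ℤ)`-orbits of integral binary forms through an equivariant map to `ℍ` (Gauss;
Davenport 1951; Bhargava–Shankar–Tsimerman 2013 §5.1: "`ν(a)` is the union of either one or two
subintervals of `[−½, ½]`" — Gauss's domain for `GL₂(ℤ)\\GL₂(ℝ)` is half of that of `SL₂(ℤ)`) one
needs a fundamental domain for the FULL group `GL₂(ℤ)`, in which `−1` acts trivially and the matrices
of determinant `−1` act by orientation-reversing isometries: the reflection `diag(−1, 1)` acts by
`z ↦ −z̄`, folding `𝒟` onto its half `𝒟⁺ = {z ∈ 𝒟 : 0 ≤ Re z}`. This file PROVES: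
* `glIntHom : GL₂(ℤ) →* GL(2, ℝ)`, `glIntHom_toGL_smul` (compatibility with Mathlib's `SL(2, ℤ)`-action),
  `reflect = diag(−1,1)`, `coe_reflect_smul` (`z ↦ −z̄`), `glIntHom_neg_one_smul` (`−1` acts trivially);
* `fdPlus = 𝒟⁺`, `fdPlusInt = {z ∈ 𝒟ᵒ : 0 < Re z}`;
* **`exists_glInt_smul_mem_fdPlus`** — every `z ∈ ℍ` has a `GL₂(ℤ)`-translate in `𝒟⁺`;
* **`eq_one_or_neg_one_of_smul_mem_fdPlusInt`** — if `z` and `γ • z` both lie in the interior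
  `{z ∈ 𝒟ᵒ : 0 < Re z}` then `γ = ±1`; `glInt_smul_mem_fdPlusInt_iff`.

## References

* M. Bhargava, A. Shankar, J. Tsimerman, *On the Davenport–Heilbronn theorems and second order
  terms*, Invent. Math. 193 (2013) 439–499 = arXiv:1005.0672, §5.1 (Gauss's fundamental domain for
  GL₂(ℤ)\GL₂(ℝ)) [BhargavaShankarTsimerman2012].
* J.-P. Serre, *A Course in Arithmetic*, GTM 7, Springer 1973, Ch. VII §1 (the fundamental domain of
  the modular group; Mathlib `Mathlib.NumberTheory.Modular`).
-/

noncomputable section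

open Matrix UpperHalfPlane ModularGroup Matrix.SpecialLinearGroup
open scoped MatrixGroups ComplexConjugate Modular

namespace Literature.NumberTheory.ModularForms

/-! ### `GL₂(ℤ)` inside `GL(2, ℝ)`; the reflection `z ↦ −z̄` -/

/-- The inclusion `GL₂(ℤ) →* GL(2, ℝ)` (entrywise cast); through it `GL₂(ℤ)` acts on `ℍ` by Mathlib's
`UpperHalfPlane.glAction` (Möbius transformations, composed with `z ↦ z̄` when `det = −1`). [folklore] -/
def glIntHom : GL (Fin 2) ℤ →* GL (Fin 2) ℝ := Matrix.GeneralLinearGroup.map (Int.castRingHom ℝ)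

/-- Entries of `glIntHom γ`. [folklore] -/
@[simp] theorem glIntHom_apply (γ : GL (Fin 2) ℤ) (i j : Fin 2) :
    (glIntHom γ : Matrix (Fin 2) (Fin 2) ℝ) i j = ((γ : Matrix (Fin 2) (Fin 2) ℤ) i j : ℝ) := rfl

/-- The determinant of `glIntHom γ` is `det γ = ±1` cast to `ℝ`. [folklore] -/
theorem det_glIntHom (γ : GL (Fin 2) ℤ) : (glIntHom γ).det.val = ((γ.det : ℤˣ) : ℤ) := by
  change ((γ : Matrix (Fin 2) (Fin 2) ℤ).map (Int.castRingHom ℝ)).det = _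
  rw [← RingHom.mapMatrix_apply, ← RingHom.map_det]
  rfl

/-- **Compatibility with Mathlib's `SL(2, ℤ)`-action**: for `g ∈ SL(2, ℤ)`, `glIntHom g • z = g • z`. [folklore] -/
theorem glIntHom_toGL_smul (g : SL(2, ℤ)) (z : ℍ) : glIntHom (toGL g) • z = g • z := by
  have h : glIntHom (toGL g) = mapGL ℝ g := by
    ext i j
    simp [glIntHom, mapGL]
  rw [h]
  rfl

/-- `−1 ∈ GL₂(ℤ)` acts trivially on `ℍ`. [folklore] -/
theorem glIntHom_neg_smul (γ : GL (Fin 2) ℤ) (z : ℍ) : glIntHom (-γ) • z = glIntHom γ • z := by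
  have : glIntHom (-γ) = -glIntHom γ := by ext i j; simp [glIntHom]
  rw [this, UpperHalfPlane.neg_smul]

/-- `−1` acts trivially. [folklore] -/
theorem glIntHom_neg_one_smul (z : ℍ) : glIntHom (-1) • z = z := by
  rw [glIntHom_neg_smul, map_one, one_smul]

/-- The reflection `diag(−1, 1) ∈ GL₂(ℤ)` (determinant `−1`, an involution). [folklore] -/
def reflect : GL (Fin 2) ℤ :=
  ⟨!![-1, 0; 0, 1], !![-1, 0; 0, 1], by ext i j; fin_cases i <;> fin_cases j <;> simp, by
    ext i j; fin_cases i <;> fin_cases j <;> simp⟩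

/-- `reflect² = 1`. [folklore] -/
@[simp] theorem reflect_mul_reflect : reflect * reflect = 1 := by
  ext i j; fin_cases i <;> fin_cases j <;> simp [reflect]

/-- `det reflect = −1`. [folklore] -/
theorem det_reflect : ((reflect.det : ℤˣ) : ℤ) = -1 := by
  simp [reflect, Matrix.GeneralLinearGroup.val_det_apply, Matrix.det_fin_two_of]

/-- **The reflection acts by `z ↦ −z̄`.** [folklore] -/
theorem coe_reflect_smul (z : ℍ) : ((glIntHom reflect • z : ℍ) : ℂ) = -conj (z : ℂ) := by
  have hdet : ¬ (0 : ℝ) < (glIntHom reflect).det.val := by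
    rw [det_glIntHom, det_reflect]; norm_num
  rw [UpperHalfPlane.coe_smul, UpperHalfPlane.σ, if_neg hdet, UpperHalfPlane.num, UpperHalfPlane.denom]
  simp [reflect, glIntHom, map_neg]

/-- The reflection negates the real part. [folklore] -/
theorem re_reflect_smul (z : ℍ) : (glIntHom reflect • z).re = -z.re := by
  rw [← UpperHalfPlane.coe_re, coe_reflect_smul]
  simp

/-- The reflection preserves the imaginary part. [folklore] -/
theorem im_reflect_smul (z : ℍ) : (glIntHom reflect • z).im = z.im := by
  rw [← UpperHalfPlane.coe_im, coe_reflect_smul]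
  simp

/-- The reflection preserves `|z|²`. [folklore] -/
theorem normSq_reflect_smul (z : ℍ) : Complex.normSq ((glIntHom reflect • z : ℍ) : ℂ) = Complex.normSq (z : ℂ) := by
  rw [coe_reflect_smul, Complex.normSq_neg, Complex.normSq_conj]

/-- The reflection preserves `𝒟` and `𝒟ᵒ`. [folklore] -/
theorem reflect_smul_mem_fd_iff (z : ℍ) : glIntHom reflect • z ∈ 𝒟 ↔ z ∈ 𝒟 := by
  simp only [ModularGroup.fd, Set.mem_setOf_eq, normSq_reflect_smul, re_reflect_smul, abs_neg]

/-- The reflection preserves `𝒟ᵒ`. [folklore] -/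
theorem reflect_smul_mem_fdo_iff (z : ℍ) : glIntHom reflect • z ∈ 𝒟ᵒ ↔ z ∈ 𝒟ᵒ := by
  simp only [ModularGroup.fdo, Set.mem_setOf_eq, normSq_reflect_smul, re_reflect_smul, abs_neg]

/-! ### Every element of `GL₂(ℤ)` is `g` or `reflect · g` with `g ∈ SL(2, ℤ)` -/

/-- `det γ = 1` or `det γ = −1` for `γ ∈ GL₂(ℤ)`. [folklore] -/
theorem det_eq_one_or (γ : GL (Fin 2) ℤ) : γ.det = 1 ∨ γ.det = -1 := Int.units_eq_one_or _

/-- An element of determinant `1` comes from `SL(2, ℤ)`. [folklore] -/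
theorem exists_toGL_eq_of_det_eq_one {γ : GL (Fin 2) ℤ} (h : γ.det = 1) : ∃ g : SL(2, ℤ), toGL g = γ := by
  refine ⟨⟨(γ : Matrix (Fin 2) (Fin 2) ℤ), ?_⟩, Units.ext rfl⟩
  have := congrArg (fun u : ℤˣ => (u : ℤ)) h
  simpa [Matrix.GeneralLinearGroup.val_det_apply] using this

/-- An element of determinant `−1` is `reflect · g` with `g ∈ SL(2, ℤ)`. [folklore] -/
theorem exists_reflect_mul_toGL_eq_of_det_eq_neg_one {γ : GL (Fin 2) ℤ} (h : γ.det = -1) :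
    ∃ g : SL(2, ℤ), reflect * toGL g = γ := by
  have hrefl : reflect.det = -1 := Units.ext (by rw [det_reflect]; rfl)
  have hdet : (reflect * γ).det = 1 := by
    rw [map_mul, h, hrefl, neg_mul_neg, one_mul]
  obtain ⟨g, hg⟩ := exists_toGL_eq_of_det_eq_one hdet
  refine ⟨g, ?_⟩
  rw [hg, ← mul_assoc, reflect_mul_reflect, one_mul]

/-! ### The fundamental domain `𝒟⁺` for `GL₂(ℤ)` -/

/-- **`𝒟⁺ = {z ∈ 𝒟 : 0 ≤ Re z}`**, a (closed) fundamental domain for `GL₂(ℤ)` acting on `ℍ` through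
`glIntHom` — half of the modular triangle (Gauss's domain for `GL₂(ℤ)\GL₂(ℝ)`, BST §5.1). [cite: BhargavaShankarTsimerman2012, §5.1 (Gauss's fundamental domain for GL₂(ℤ)\GL₂(ℝ); ν(a) ⊆ [−½, ½])] -/
def fdPlus : Set ℍ := {z | z ∈ 𝒟 ∧ 0 ≤ z.re}

/-- The interior part `{z ∈ 𝒟ᵒ : 0 < Re z}` of `𝒟⁺` (points with trivial stabiliser in `PGL₂(ℤ)`). [folklore] -/
def fdPlusInt : Set ℍ := {z | z ∈ 𝒟ᵒ ∧ 0 < z.re}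

/-- `fdPlusInt ⊆ fdPlus`. [folklore] -/
theorem fdPlusInt_subset_fdPlus : fdPlusInt ⊆ fdPlus := fun _ ⟨h1, h2⟩ => ⟨fdo_subset_fd h1, h2.le⟩

/-- **Existence of a representative**: every point of `ℍ` has a `GL₂(ℤ)`-translate in `𝒟⁺` (a translate in
`𝒟` by `SL(2, ℤ)`, Mathlib's `exists_smul_mem_fd`, then reflect if its real part is negative). [cite: BhargavaShankarTsimerman2012, §5.1] -/
theorem exists_glInt_smul_mem_fdPlus (z : ℍ) : ∃ γ : GL (Fin 2) ℤ, glIntHom γ • z ∈ fdPlus := by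
  obtain ⟨g, hg⟩ := ModularGroup.exists_smul_mem_fd z
  by_cases h : 0 ≤ (g • z).re
  · exact ⟨toGL g, by rw [glIntHom_toGL_smul]; exact ⟨hg, h⟩⟩
  · refine ⟨reflect * toGL g, ?_⟩
    rw [map_mul, mul_smul, glIntHom_toGL_smul]
    refine ⟨(reflect_smul_mem_fd_iff _).mpr hg, ?_⟩
    rw [re_reflect_smul]
    linarith [not_le.mp h]

/-- **Uniqueness on the interior**: if `z` and `γ • z` both lie in `{z ∈ 𝒟ᵒ : 0 < Re z}` then `γ = ±1`
(for `det γ = 1` this is Mathlib's `eq_one_or_neg_one_of_mem_fdo_mem_fdo`; for `det γ = −1`, `γ = reflect·g`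
and `g • z ∈ 𝒟ᵒ` would have negative real part although `g = ±1`). [cite: BhargavaShankarTsimerman2012, §5.1] -/
theorem eq_one_or_neg_one_of_smul_mem_fdPlusInt {z : ℍ} {γ : GL (Fin 2) ℤ} (hz : z ∈ fdPlusInt)
    (hγ : glIntHom γ • z ∈ fdPlusInt) : γ = 1 ∨ γ = -1 := by
  rcases det_eq_one_or γ with h | h
  · obtain ⟨g, rfl⟩ := exists_toGL_eq_of_det_eq_one h
    rw [glIntHom_toGL_smul] at hγ
    rcases ModularGroup.eq_one_or_neg_one_of_mem_fdo_mem_fdo hz.1 hγ.1 with rfl | rfl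
    · exact Or.inl (map_one _)
    · exact Or.inr (Units.ext (by simp))
  · exfalso
    obtain ⟨g, rfl⟩ := exists_reflect_mul_toGL_eq_of_det_eq_neg_one h
    rw [map_mul, mul_smul, glIntHom_toGL_smul] at hγ
    have hfdo : g • z ∈ 𝒟ᵒ := (reflect_smul_mem_fdo_iff _).mp hγ.1
    have hre : (g • z).re < 0 := by
      have := hγ.2
      rw [re_reflect_smul] at this
      linarith
    have hgz : g • z = z := by
      rcases ModularGroup.eq_one_or_neg_one_of_mem_fdo_mem_fdo hz.1 hfdo with rfl | rfl
      · exact one_smul _ _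
      · exact ModularGroup.SL_neg_smul (g := 1) z ▸ one_smul _ _
    rw [hgz] at hre
    linarith [hz.2]

/-- The interior representative is unique up to `±1`: `γ • z ∈ fdPlusInt ↔ γ = ±1` for `z ∈ fdPlusInt`. [folklore] -/
theorem glInt_smul_mem_fdPlusInt_iff {z : ℍ} (hz : z ∈ fdPlusInt) (γ : GL (Fin 2) ℤ) :
    glIntHom γ • z ∈ fdPlusInt ↔ γ = 1 ∨ γ = -1 := by
  refine ⟨eq_one_or_neg_one_of_smul_mem_fdPlusInt hz, ?_⟩
  rintro (rfl | rfl)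
  · rwa [map_one, one_smul]
  · rwa [glIntHom_neg_one_smul]

end Literature.NumberTheory.ModularForms

end
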